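import Summits.BirchSwinnertonDyer.BirchSwinnertonDyer.Theses.ManinLocalTwoThree
import HarnessLib

/-!
# Route `ManinLocalTwoThree` (cell `bsd-f2-manin`, rung F2-MANIN = Manin's conjecture
# `Rank1Residual.ManinConstant.ManinConstantOne`): the ASSEMBLY item (stmt-BirchSwinnertonDyer-22450)
# PROVED — pure logic over the route's items BY NAME.

`Assembly := PrintedSemistableManinFacts → ManinOddAtFour → ManinPrimeToThreeAtNine →
ManinPrimeToAdditiveFiveLe → ManinConstantOneRung` (route file
`Summits/BirchSwinnertonDyer/BirchSwinnertonDyer/Theses/ManinLocalTwoThree.lean`, planner-of-record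
`bsd-f2-manin-imc` g7; typed by the cell typer at the planner's request and landed by prover seat
bsd-line-manin23-p3, proof = the planner's `assembly_holds` sketch re-derived against the EDIT-2 item shapes, in which each crux takes the four
printed facts as leading hypotheses). PROOF: `|c| = 1` iff no prime divides the (nonzero) integer `c`;
for a prime `p ∣ c`: if `p² ∤ N`, Česnavičius 2018 Thm. 1.2 in the tree's by-name form
`cesnavicius2018_not_dvd_maninConstant_of_not_sq_dvd_level` (= Mazur 1978 Cor. 4.1 for odd `p`,
Abbes–Ullmo 1996 Thm. A for `p = 2 ∤ N`, Česnavičius for `2 ∥ N` — the first three conjuncts of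
`PrintedSemistableManinFacts`); if `p² ∣ N`: `p = 2` is `ManinOddAtFour`, `p = 3` is
`ManinPrimeToThreeAtNine`, `p ≥ 5` (`Nat.Prime.five_le_of_ne_two_of_ne_three`) is
`ManinPrimeToAdditiveFiveLe`, each fed the four conjuncts of `PrintedSemistableManinFacts`. Nothing about
BSD or Manin's conjecture is proved here: the cruxes remain hypotheses of the deciding theorem `closes`.
[cite: Cesnavicius2018, Thm. 1.2] [cite: Mazur1978, Cor. 4.1] [cite: AbbesUllmo1996, Thm. A]
-/

set_option autoImplicit false
set_option linter.dupNamespace false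

noncomputable section

namespace Summit.BirchSwinnertonDyer.BirchSwinnertonDyer.Theorems

open Literature.NumberTheory.EllipticCurves.ModularForms
open Summit.BirchSwinnertonDyer.BirchSwinnertonDyer.Theses.ManinLocalTwoThree

/-- **The Assembly item of route `ManinLocalTwoThree` (stmt-BirchSwinnertonDyer-22450), PROVED:**
`PrintedSemistableManinFacts → ManinOddAtFour → ManinPrimeToThreeAtNine → ManinPrimeToAdditiveFiveLe →
ManinConstantOneRung`. Prime by prime on a prime divisor `p` of the Manin constant `c` of an optimal
datum `D` at level `N`: `p² ∤ N` — the printed semistable-prime facts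
(`cesnavicius2018_not_dvd_maninConstant_of_not_sq_dvd_level`); `p² ∣ N` — the crux at `2`, at `3`, or
the residual crux at `p ≥ 5`. [cite: Cesnavicius2018, Thm. 1.2] -/
theorem maninLocalTwoThree_assembly_proof :
    Summit.BirchSwinnertonDyer.BirchSwinnertonDyer.Theses.ManinLocalTwoThree.Assembly := by
  unfold Summit.BirchSwinnertonDyer.BirchSwinnertonDyer.Theses.ManinLocalTwoThree.Assembly
  intro hPF h2 h3 h5 W _ _ N _ D hL
  obtain ⟨hM, hAU, hC, hnf⟩ := hPF
  by_contra hne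
  have h1 : D.maninConstant.natAbs ≠ 1 := by
    intro h
    exact hne (by rw [Int.abs_eq_natAbs, h, Nat.cast_one])
  obtain ⟨p, hp, hpd⟩ := Nat.exists_prime_and_dvd h1
  have hpc : (p : ℤ) ∣ D.maninConstant := Int.natCast_dvd.mpr hpd
  by_cases hsq : p ^ 2 ∣ N
  · rcases eq_or_ne p 2 with rfl | hp2
    · exact h2 hM hAU hC hnf W D hL hsq hpc
    rcases eq_or_ne p 3 with rfl | hp3
    · exact h3 hM hAU hC hnf W D hL hsq hpc
    exact h5 hM hAU hC hnf W D hL p hp (hp.five_le_of_ne_two_of_ne_three hp2 hp3) hsq hpc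
  · exact cesnavicius2018_not_dvd_maninConstant_of_not_sq_dvd_level hM hAU hC W D hL hp hsq hpc

end Summit.BirchSwinnertonDyer.BirchSwinnertonDyer.Theorems

end
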